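import Mathlib
import Summits.KontsevichZagierPeriods.KontsevichZagierPeriods.Theorems.InverseLandauTateLiftingRotationBalls
import Summits.KontsevichZagierPeriods.KontsevichZagierPeriods.Theorems.InverseLandauTateLiftingTranscSector
import Literature.NumberTheory.Transcendental.KZRulesAssociator

/-!
# `TateLifting` (stmt-KontsevichZagierPeriods-9129), line `Sketch`, stub `stub_ballOdd` — odd balls inside the rules

Crux `Summit.KontsevichZagierPeriods.KontsevichZagierPeriods.Theses.InverseLandau.TateLifting`, wave c9-4,
stub 64. **`(2k+1)‼ · ⟦B̄₂ₖ₊₁⟧ = 2ᵏ⁺¹ · ⟦π⟧ᵏ` in the formal period ring `P = FormalRep ⧸ relations`**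
(Archimedes `3·⟦B̄₃⟧ = 4·⟦π⟧` at `k = 1`), GIVEN the value `vol B̄₂ₖ₊₁ = πᵏ 2ᵏ⁺¹ / (2k+1)‼` of the
integrand-`1` representation over the closed unit ball of `ℝ²ᵏ⁺¹` as hypothesis (stub 62).

Proof: `ball_mem_piSubring` (rotation sector, at the constant polynomial `1`) puts `⟦B̄₂ₖ₊₁⟧` in the
subring `K₀[⟦π⟧]` of `P` generated by the dimension-zero classes and the disc; `transcRingKernel` at the
family `![⟦π⟧]` (Lindemann read in `P`, `Transc.algebraicIndependent_vecPi`) makes `evalP` injective on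
`K₀[⟦π⟧]`; and `y := (2k+1)‼ · ⟦B̄₂ₖ₊₁⟧ − 2ᵏ⁺¹ · ⟦π⟧ᵏ ∈ K₀[⟦π⟧]` evaluates to
`(2k+1)‼ · vol B̄₂ₖ₊₁ − 2ᵏ⁺¹ πᵏ = 0`.

References: M. Kontsevich, D. Zagier, *Periods* (2001), §1.2; F. Lindemann (1882) through
`transcendental_pi_holds`.
-/

noncomputable section

open MeasureTheory Set
open Literature.NumberTheory.Transcendental

namespace Summit.KontsevichZagierPeriods.InverseLandau

namespace BallOdd

/-- `(2k+1)‼ · ⟦B̄₂ₖ₊₁⟧ − 2ᵏ⁺¹ · ⟦π⟧ᵏ ∈ K₀[⟦π⟧]`, the subring of `P` generated by the dimension-zero classes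
and the family `![⟦π⟧]`: `⟦B̄₂ₖ₊₁⟧` lies there by `ball_mem_piSubring` at the constant polynomial `1`
(`{⟦π⟧} ⊆ range ![⟦π⟧]`), and subrings contain the numerals and are closed under `*`, `^`, `-`. [folklore] -/
theorem sub_mem (k : ℕ) (b : KZ.IntegralRep (2 * k + 1))
    (hb : b.domain = {v | ∑ j, v j ^ 2 ≤ 1}) (hbi : ∀ v ∈ b.domain, b.integrand v = 1) :
    (Nat.doubleFactorial (2 * k + 1) : KZ.FormalPeriodRing) * KZ.toFormalPeriod (KZ.of b) -
        2 ^ (k + 1) * KZ.toFormalPeriod (KZ.of KZ.piRep) ^ k ∈ Subring.closure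
      (Set.range (fun b : KZ.IntegralRep 0 => KZ.toFormalPeriod (KZ.of b)) ∪
        Set.range (![KZ.toFormalPeriod (KZ.of KZ.piRep)] : Fin 1 → KZ.FormalPeriodRing)) := by
  have hsub : Set.range (fun b : KZ.IntegralRep 0 => KZ.toFormalPeriod (KZ.of b)) ∪
      {KZ.toFormalPeriod (KZ.of KZ.piRep)} ⊆
      Set.range (fun b : KZ.IntegralRep 0 => KZ.toFormalPeriod (KZ.of b)) ∪
        Set.range (![KZ.toFormalPeriod (KZ.of KZ.piRep)] : Fin 1 → KZ.FormalPeriodRing) := by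
    refine Set.union_subset_union_right _ ?_
    rintro _ rfl
    exact ⟨0, by simp⟩
  have hball := Subring.closure_mono hsub
    (ball_mem_piSubring (2 * k + 1) 1 b hb (fun v hv => by simp only [hbi v hv, map_one]))
  have hpi : KZ.toFormalPeriod (KZ.of KZ.piRep) ∈ Subring.closure
      (Set.range (fun b : KZ.IntegralRep 0 => KZ.toFormalPeriod (KZ.of b)) ∪
        Set.range (![KZ.toFormalPeriod (KZ.of KZ.piRep)] : Fin 1 → KZ.FormalPeriodRing)) :=
    Subring.subset_closure (Or.inr ⟨0, by simp⟩)
  exact Subring.sub_mem _ (Subring.mul_mem _ (natCast_mem _ _) hball)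
    (Subring.mul_mem _ (Subring.pow_mem _ (ofNat_mem _ 2) _) (Subring.pow_mem _ hpi _))

/-- `evalP ((2k+1)‼ · ⟦B̄₂ₖ₊₁⟧ − 2ᵏ⁺¹ · ⟦π⟧ᵏ) = (2k+1)‼ · vol B̄₂ₖ₊₁ − 2ᵏ⁺¹ πᵏ = 0`, given
`vol B̄₂ₖ₊₁ = πᵏ 2ᵏ⁺¹ / (2k+1)‼` (`evalP` is a ring map, `evalP ⟦[r]⟧ = value r`, `value [π] = π`,
`(2k+1)‼ ≠ 0`). [folklore] -/
theorem evalP_sub_eq_zero (k : ℕ) (b : KZ.IntegralRep (2 * k + 1))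
    (hv : b.value = Real.pi ^ k * 2 ^ (k + 1) / (Nat.doubleFactorial (2 * k + 1) : ℝ)) :
    KZ.evalP ((Nat.doubleFactorial (2 * k + 1) : KZ.FormalPeriodRing) * KZ.toFormalPeriod (KZ.of b) -
        2 ^ (k + 1) * KZ.toFormalPeriod (KZ.of KZ.piRep) ^ k) = 0 := by
  rw [map_sub, map_mul, map_mul, map_pow, map_pow, map_natCast, map_ofNat,
    KZ.evalP_toFormalPeriod_of, KZ.evalP_toFormalPeriod_of, KZ.piRep_value, hv]
  have hne : ((Nat.doubleFactorial (2 * k + 1) : ℕ) : ℝ) ≠ 0 := by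
    exact_mod_cast (Nat.doubleFactorial_pos _).ne'
  rw [mul_div_cancel₀ _ hne]
  ring

end BallOdd

/-- **ODD BALLS INSIDE THE RULES** (stub `stub_ballOdd` of line `Sketch` for crux `TateLifting`):
`(2k+1)‼ · ⟦B̄₂ₖ₊₁⟧ = 2ᵏ⁺¹ · ⟦π⟧ᵏ` in the formal period ring (Archimedes `3·⟦B̄₃⟧ = 4·⟦π⟧` at `k = 1`),
given the value `vol B̄₂ₖ₊₁ = πᵏ 2ᵏ⁺¹ / (2k+1)‼` of the integrand-`1` closed-ball representation:
`ball_mem_piSubring` puts `⟦B̄₂ₖ₊₁⟧` in `K₀[⟦π⟧]`, where `evalP` is injective by `transcRingKernel`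
(Lindemann in `P`), and both sides have the same value. [cite: KontsevichZagier2001, §1.2] -/
theorem tateLifting_ballOdd :
    (∀ (k : ℕ) (b : KZ.IntegralRep (2 * k + 1)), b.domain = {v | ∑ j, v j ^ 2 ≤ 1} →
      (∀ v ∈ b.domain, b.integrand v = 1) →
      b.value = Real.pi ^ k * 2 ^ (k + 1) / (Nat.doubleFactorial (2 * k + 1) : ℝ)) →
    ∀ (k : ℕ) (b : KZ.IntegralRep (2 * k + 1)), b.domain = {v | ∑ j, v j ^ 2 ≤ 1} →
      (∀ v ∈ b.domain, b.integrand v = 1) →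
      (Nat.doubleFactorial (2 * k + 1) : KZ.FormalPeriodRing) * KZ.toFormalPeriod (KZ.of b) =
        2 ^ (k + 1) * KZ.toFormalPeriod (KZ.of KZ.piRep) ^ k := by
  intro hV k b hb hbi
  exact sub_eq_zero.1 (transcRingKernel _ Transc.algebraicIndependent_vecPi _
    (BallOdd.sub_mem k b hb hbi) (BallOdd.evalP_sub_eq_zero k b (hV k b hb hbi)))

end Summit.KontsevichZagierPeriods.InverseLandau
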